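import Summits.NavierStokesRegularity.NavierStokesRegularity.Theorems.EfficiencyFloorRigidExitReferenceFlowContinuity
import HarnessLib

/-!
# Route `EfficiencyFloor`, support `RigidExit` (stmt-NavierStokesRegularity-25513) on the `ProductionEfficiencyDecay`
# ladder (stmt-NavierStokesRegularity-22866): THE REFERENCE FLOW — a priori enstrophy ceiling on the window, no positivity
# hypothesis

Helper file (`--supports stmt-NavierStokesRegularity-22866`; line `efficiency_floor`), continuing p839713 / p839755. The rung-zero
bounds landed there (`ReferenceFlow.inv_sq_sub_inv_sq_le`, `…_le_zero`) are written with `Z⁻²` and therefore ASSUME the enstrophy of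
the reference flow stays positive — automatic for the blow-up class of the route, but not for Leray's flow through a maximiser
(zero enstrophy at a later time is only excluded by backward uniqueness). What the early-deficit transfer consumes is an UPPER bound
on the reference enstrophy, and that needs no positivity. This file proves it:

* `inv_sq_sub_inv_sq_le_local` — the interior rung zero with positivity asked only on the integration range `[t₁, t₂)`;
* `enstrophy_continuousWithinAt_zero`, `enstrophy_continuousAt` — continuity of `t ↦ Z(v t)` on `[0,T)`;
* `enstrophy_pos_of_pos_right` — if `Z(v t) > 0` at some `t ∈ (0,T)` then `Z(v s) > 0` on all of `[0,t]` (a zero of the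
  enstrophy followed by a positive value would violate rung zero, whose left end blows up at the zero);
* `enstrophy_sq_mul_le` — **THE WINDOW CEILING**: for every `t ∈ [0,T)`,
  `Z(v t)² · (1 − 2K·Z(m)²·t) ≤ Z(m)²`, `K = 27c⁴/(128ν³)` for any one-sided admissible Lu–Doering constant `c` — i.e.
  `Z(v t) ≤ Z(m)/√(1 − t/W)` on the would-be blow-up window `W = (2K Z(m)²)⁻¹ = (64ν³/(27c⁴))·Z(m)⁻²`, with NO positivity
  hypothesis (where `Z(v t) = 0` the bound is trivial; elsewhere positivity propagates backwards to `0`).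

HONEST FRAMING: classical bookkeeping on the reference flow; `RigidExit`, `NearMaximiserBoundedAmplification`, `LerayFloorGap`,
`ProductionEfficiencyDecay` (stmt-22866) and Navier–Stokes regularity stay OPEN; no summit statement is proved. [folklore]
-/

-- the problem directory repeats the summit name (`NavierStokesRegularity/NavierStokesRegularity`)
set_option linter.dupNamespace false

noncomputable section

open Set Filter MeasureTheory Topology Function
open scoped InnerProductSpace RealInnerProductSpace ENNReal NNReal ContDiff
open Literature.Analysis.FluidPDE

namespace Summit.NavierStokesRegularity.NavierStokesRegularity.Theorems

namespace RigidExit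

namespace ReferenceFlow

section Window

variable {ν T : ℝ} {m : EuclideanSpace ℝ (Fin 3) → EuclideanSpace ℝ (Fin 3)}
  {v : ℝ → EuclideanSpace ℝ (Fin 3) → EuclideanSpace ℝ (Fin 3)} {q : ℝ → EuclideanSpace ℝ (Fin 3) → ℝ}

/-- **Interior rung zero, local positivity.** Along `(v,q)` classical on `(0,T]` with Sobolev bounds on every `[δ,T]`, for an
admissible Lu–Doering constant `c`: if the enstrophy is positive on `[t₁, t₂)` (`0 < t₁`, `t₂ ≤ T`) then
`Z(v s)⁻² − Z(v t)⁻² ≤ 2K(t − s)` for `t₁ ≤ s ≤ t < t₂`, `K = 27c⁴/(128ν³)`. [cite: LuDoering2008, eq. (6)] -/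
theorem inv_sq_sub_inv_sq_le_local (hν : 0 < ν) (hcl : IsClassicalNSSolutionOn (Ioc 0 T) ν 0 v q)
    (hB : ∀ δ : ℝ, 0 < δ → δ ≤ T → HasBoundedSobolevNormsOn (Icc δ T) v) {c : ℝ}
    (hc : ∀ w : EuclideanSpace ℝ (Fin 3) → EuclideanSpace ℝ (Fin 3), (ContDiff ℝ (⊤ : ℕ∞) w ∧
      VectorCalculus.IsDivFree w ∧ (∫⁻ x, ‖iteratedFDeriv ℝ 0 w x‖ₑ ^ 2 < ⊤) ∧
      (∫⁻ x, ‖iteratedFDeriv ℝ 1 w x‖ₑ ^ 2 < ⊤) ∧ (∫⁻ x, ‖iteratedFDeriv ℝ 2 w x‖ₑ ^ 2 < ⊤)) →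
      (∫ x, ⟪curl w x, fderiv ℝ w x (curl w x)⟫_ℝ) ≤ c * (∫ x, ‖curl w x‖ ^ 2) ^ (3 / 4 : ℝ) *
        (∫ x, frobeniusNormSq (fderiv ℝ (curl w) x)) ^ (3 / 4 : ℝ))
    {t₁ t₂ : ℝ} (ht₁ : 0 < t₁) (ht₂ : t₂ ≤ T) (hpos : ∀ τ ∈ Ico t₁ t₂, 0 < ∫ x, ‖curl (v τ) x‖ ^ 2)
    {s t : ℝ} (hs : t₁ ≤ s) (hst : s ≤ t) (ht : t < t₂) :
    (∫ x, ‖curl (v s) x‖ ^ 2)⁻¹ ^ 2 - (∫ x, ‖curl (v t) x‖ ^ 2)⁻¹ ^ 2 ≤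
      2 * (27 * c ^ 4 / (128 * ν ^ 3)) * (t - s) := by
  have hder : ∀ τ ∈ Ico t₁ t₂, ∃ D : ℝ, HasDerivAt (fun s => ∫ x, ‖curl (v s) x‖ ^ 2) D τ ∧
      D ≤ 27 * c ^ 4 / (128 * ν ^ 3) * (∫ x, ‖curl (v τ) x‖ ^ 2) ^ 3 := fun τ hτ =>
    ⟨_, (budget hν hcl hB hc ⟨ht₁.trans_le hτ.1, hτ.2.trans_le ht₂⟩).1,
      (budget hν hcl hB hc ⟨ht₁.trans_le hτ.1, hτ.2.trans_le ht₂⟩).2⟩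
  exact ProductionEfficiencyDecay.stub_integrateEfficiency (fun s => ∫ x, ‖curl (v s) x‖ ^ 2) t₁ t₂
    (27 * c ^ 4 / (128 * ν ^ 3)) hpos hder s t hs hst ht

/-- The enstrophy of the reference flow is continuous at every interior time (it is differentiable there). [folklore] -/
theorem enstrophy_continuousAt (hν : 0 < ν) (hcl : IsClassicalNSSolutionOn (Ioc 0 T) ν 0 v q)
    (hB : ∀ δ : ℝ, 0 < δ → δ ≤ T → HasBoundedSobolevNormsOn (Icc δ T) v) {t : ℝ} (ht : t ∈ Ioo 0 T) :
    ContinuousAt (fun s => ∫ x, ‖curl (v s) x‖ ^ 2) t :=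
  (hasDerivAt_enstrophy hν hcl hB ht).continuousAt

/-- The enstrophy of the reference flow is right-continuous at `t = 0` within `[0, ∞)`. [folklore] -/
theorem enstrophy_continuousWithinAt_zero (hT : 0 < T) (hLH : IsLerayHopfOn T ν 0 m v) (hv0 : v 0 = m)
    (hH1 : IsH1RegularOn (Icc 0 T) v) (hcl : IsClassicalNSSolutionOn (Ioc 0 T) ν 0 v q)
    (hB : ∀ δ : ℝ, 0 < δ → δ ≤ T → HasBoundedSobolevNormsOn (Icc δ T) v)
    (hm : ContDiff ℝ (⊤ : ℕ∞) m ∧ VectorCalculus.IsDivFree m ∧ (∫⁻ x, ‖iteratedFDeriv ℝ 0 m x‖ₑ ^ 2 < ⊤) ∧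
      (∫⁻ x, ‖iteratedFDeriv ℝ 1 m x‖ₑ ^ 2 < ⊤) ∧ (∫⁻ x, ‖iteratedFDeriv ℝ 2 m x‖ₑ ^ 2 < ⊤)) :
    ContinuousWithinAt (fun s => ∫ x, ‖curl (v s) x‖ ^ 2) (Ici 0) 0 := by
  rw [← continuousWithinAt_Ioi_iff_Ici, ContinuousWithinAt, hv0]
  exact tendsto_enstrophy_nhdsGT hT hLH hv0 hH1 hcl hB hm

/-- **Positivity propagates backwards.** If the enstrophy of the reference flow is positive at some `t ∈ (0,T)`, it is positive
on all of `[0, t]`: otherwise take the last zero `t₀ < t`; on `(t₀, t]` rung zero gives `Z(v s)⁻² ≤ Z(v t)⁻² + 2K t`, while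
`Z(v s) → 0` as `s ↓ t₀`. [folklore] -/
theorem enstrophy_pos_of_pos_right (hν : 0 < ν) (hT : 0 < T) (hLH : IsLerayHopfOn T ν 0 m v) (hv0 : v 0 = m)
    (hH1 : IsH1RegularOn (Icc 0 T) v) (hcl : IsClassicalNSSolutionOn (Ioc 0 T) ν 0 v q)
    (hB : ∀ δ : ℝ, 0 < δ → δ ≤ T → HasBoundedSobolevNormsOn (Icc δ T) v)
    (hm : ContDiff ℝ (⊤ : ℕ∞) m ∧ VectorCalculus.IsDivFree m ∧ (∫⁻ x, ‖iteratedFDeriv ℝ 0 m x‖ₑ ^ 2 < ⊤) ∧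
      (∫⁻ x, ‖iteratedFDeriv ℝ 1 m x‖ₑ ^ 2 < ⊤) ∧ (∫⁻ x, ‖iteratedFDeriv ℝ 2 m x‖ₑ ^ 2 < ⊤))
    {c : ℝ}
    (hc : ∀ w : EuclideanSpace ℝ (Fin 3) → EuclideanSpace ℝ (Fin 3), (ContDiff ℝ (⊤ : ℕ∞) w ∧
      VectorCalculus.IsDivFree w ∧ (∫⁻ x, ‖iteratedFDeriv ℝ 0 w x‖ₑ ^ 2 < ⊤) ∧
      (∫⁻ x, ‖iteratedFDeriv ℝ 1 w x‖ₑ ^ 2 < ⊤) ∧ (∫⁻ x, ‖iteratedFDeriv ℝ 2 w x‖ₑ ^ 2 < ⊤)) →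
      (∫ x, ⟪curl w x, fderiv ℝ w x (curl w x)⟫_ℝ) ≤ c * (∫ x, ‖curl w x‖ ^ 2) ^ (3 / 4 : ℝ) *
        (∫ x, frobeniusNormSq (fderiv ℝ (curl w) x)) ^ (3 / 4 : ℝ))
    (hZm : 0 < ∫ x, ‖curl m x‖ ^ 2) {t : ℝ} (ht : t ∈ Ioo 0 T) (hZt : 0 < ∫ x, ‖curl (v t) x‖ ^ 2) :
    ∀ s ∈ Icc 0 t, 0 < ∫ x, ‖curl (v s) x‖ ^ 2 := by
  set Z : ℝ → ℝ := fun s => ∫ x, ‖curl (v s) x‖ ^ 2 with hZdef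
  set K : ℝ := 27 * c ^ 4 / (128 * ν ^ 3) with hK
  have hZ0 : ∀ s, 0 ≤ Z s := fun s => integral_nonneg fun x => by positivity
  -- continuity of `Z` on `[0, t]`
  have hcont : ContinuousOn Z (Icc 0 t) := by
    intro s hs
    rcases hs.1.eq_or_lt with h0 | h0
    · subst h0
      exact (enstrophy_continuousWithinAt_zero hT hLH hv0 hH1 hcl hB hm).mono Icc_subset_Ici_self
    · exact (enstrophy_continuousAt hν hcl hB ⟨h0, hs.2.trans_lt ht.2⟩).continuousWithinAt
  -- positivity a little beyond `t`
  obtain ⟨t₂, ht₂t, ht₂T, hpos₂⟩ : ∃ t₂, t < t₂ ∧ t₂ ≤ T ∧ ∀ τ ∈ Icc t t₂, 0 < Z τ := by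
    have hev : ∀ᶠ τ in 𝓝 t, 0 < Z τ := (enstrophy_continuousAt hν hcl hB ht).eventually (lt_mem_nhds hZt)
    obtain ⟨ε, hε, hball⟩ := Metric.eventually_nhds_iff.1 hev
    refine ⟨min (t + ε / 2) T, lt_min (by linarith) ht.2, min_le_right _ _, fun τ hτ => hball ?_⟩
    rw [Real.dist_eq, abs_lt]
    constructor <;> linarith [hτ.1, hτ.2, min_le_left (t + ε / 2) T]
  by_contra hneg
  push Not at hneg
  -- the zero set in `[0, t]` is closed and nonempty; take its maximum `t₀`
  set A : Set ℝ := Icc 0 t ∩ Z ⁻¹' {0} with hA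
  have hAne : A.Nonempty := by
    obtain ⟨s, hs, hle⟩ := hneg
    exact ⟨s, hs, le_antisymm hle (hZ0 s)⟩
  have hAcl : IsClosed A := hcont.preimage_isClosed_of_isClosed isClosed_Icc isClosed_singleton
  have hAbdd : BddAbove A := ⟨t, fun s hs => hs.1.2⟩
  set t₀ := sSup A with ht₀
  have ht₀A : t₀ ∈ A := hAcl.csSup_mem hAne hAbdd
  have hZt₀ : Z t₀ = 0 := ht₀A.2
  have ht₀t : t₀ ≤ t := ht₀A.1.2
  have ht₀0 : 0 < t₀ := by
    rcases ht₀A.1.1.eq_or_lt with h | h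
    · exfalso
      have : Z 0 = ∫ x, ‖curl m x‖ ^ 2 := by simp only [hZdef, hv0]
      rw [← h, this] at hZt₀
      exact hZm.ne' hZt₀
    · exact h
  have ht₀lt : t₀ < t := lt_of_le_of_ne ht₀t fun h => hZt.ne' (by rw [← h]; exact hZt₀)
  -- positivity on `(t₀, t₂]`
  have hposI : ∀ τ, t₀ < τ → τ ≤ t₂ → 0 < Z τ := by
    intro τ h1 h2
    rcases le_or_gt t τ with h3 | h3
    · exact hpos₂ τ ⟨h3, h2⟩
    · by_contra h4
      have hτA : τ ∈ A := ⟨⟨ht₀0.le.trans h1.le, h3.le⟩, le_antisymm (not_lt.1 h4) (hZ0 τ)⟩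
      exact (lt_irrefl τ) (h1.trans_le' (le_csSup hAbdd hτA))
  -- rung zero from `s ∈ (t₀, t)` to `t`: `Z(s)⁻² ≤ Z(t)⁻² + 2K t`
  have hrung : ∀ s, t₀ < s → s < t → (Z s)⁻¹ ^ 2 ≤ (Z t)⁻¹ ^ 2 + 2 * K * t := by
    intro s h1 h2
    have h := inv_sq_sub_inv_sq_le_local hν hcl hB hc (ht₀0.trans h1) ht₂T
      (fun τ hτ => hposI τ (h1.trans_le hτ.1) hτ.2.le) le_rfl h2.le ht₂t
    have hK0 : 0 ≤ K := by positivity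
    have : 2 * K * (t - s) ≤ 2 * K * t := by nlinarith [ht₀0.le.trans h1.le]
    simp only [hZdef] at h ⊢
    linarith
  -- but `Z(s) → Z(t₀) = 0` as `s ↓ t₀`
  have hK0 : 0 ≤ K := by rw [hK]; positivity
  set L : ℝ := (Z t)⁻¹ ^ 2 + 2 * K * t + 1 with hL
  have hLpos : 0 < L := by
    have h1 : 0 ≤ (Z t)⁻¹ ^ 2 := sq_nonneg _
    have h2 : 0 ≤ 2 * K * t := by have := ht.1.le; positivity
    linarith
  have hcont₀ : ContinuousAt Z t₀ := enstrophy_continuousAt hν hcl hB ⟨ht₀0, ht₀t.trans_lt ht.2⟩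
  have hev : ∀ᶠ s in 𝓝 t₀, Z s < L⁻¹ ^ (1 / 2 : ℝ) :=
    hcont₀.eventually (gt_mem_nhds (show Z t₀ < L⁻¹ ^ (1 / 2 : ℝ) by rw [hZt₀]; positivity))
  have hev' : ∀ᶠ s in 𝓝[>] t₀, Z s < L⁻¹ ^ (1 / 2 : ℝ) ∧ s ∈ Ioo t₀ t :=
    (hev.filter_mono nhdsWithin_le_nhds).and (Ioo_mem_nhdsGT ht₀lt)
  obtain ⟨s, hsZ, hs⟩ := hev'.exists
  have hZs : 0 < Z s := hposI s hs.1 (hs.2.le.trans ht₂t.le)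
  have h1 : L < (Z s)⁻¹ ^ 2 := by
    -- `Z s < L^{-1/2}` ⟹ `Z s ^ 2 < L⁻¹` ⟹ `L < (Z s)⁻²`
    have h2 : Z s ^ 2 < L⁻¹ := by
      have h3 : (L⁻¹ ^ (1 / 2 : ℝ)) ^ 2 = L⁻¹ := by
        rw [← Real.rpow_natCast, ← Real.rpow_mul (inv_nonneg.2 hLpos.le)]; norm_num
      calc Z s ^ 2 < (L⁻¹ ^ (1 / 2 : ℝ)) ^ 2 := pow_lt_pow_left₀ hsZ (hZ0 s) two_ne_zero
        _ = L⁻¹ := h3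
    rw [inv_pow]
    rwa [lt_inv_comm₀ hLpos (pow_pos hZs 2)]
  have h4 := hrung s hs.1 hs.2
  linarith

/-- **THE WINDOW CEILING (no positivity hypothesis).** For the reference flow `(v,q)` through an admissible `m` with `Z(m) > 0`
and any one-sided admissible Lu–Doering constant `c`: for every `t ∈ [0,T)`,
`Z(v t)² · (1 − 2·(27c⁴/(128ν³))·Z(m)²·t) ≤ Z(m)²`. In particular `Z(v t) ≤ Z(m)/√(1 − η)` at `t = η·(64ν³/(27c⁴))·Z(m)⁻²`,
`0 ≤ η < 1`. [cite: LuDoering2008, eq. (6)] -/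
theorem enstrophy_sq_mul_le (hν : 0 < ν) (hT : 0 < T) (hLH : IsLerayHopfOn T ν 0 m v) (hv0 : v 0 = m)
    (hH1 : IsH1RegularOn (Icc 0 T) v) (hcl : IsClassicalNSSolutionOn (Ioc 0 T) ν 0 v q)
    (hB : ∀ δ : ℝ, 0 < δ → δ ≤ T → HasBoundedSobolevNormsOn (Icc δ T) v)
    (hm : ContDiff ℝ (⊤ : ℕ∞) m ∧ VectorCalculus.IsDivFree m ∧ (∫⁻ x, ‖iteratedFDeriv ℝ 0 m x‖ₑ ^ 2 < ⊤) ∧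
      (∫⁻ x, ‖iteratedFDeriv ℝ 1 m x‖ₑ ^ 2 < ⊤) ∧ (∫⁻ x, ‖iteratedFDeriv ℝ 2 m x‖ₑ ^ 2 < ⊤))
    {c : ℝ}
    (hc : ∀ w : EuclideanSpace ℝ (Fin 3) → EuclideanSpace ℝ (Fin 3), (ContDiff ℝ (⊤ : ℕ∞) w ∧
      VectorCalculus.IsDivFree w ∧ (∫⁻ x, ‖iteratedFDeriv ℝ 0 w x‖ₑ ^ 2 < ⊤) ∧
      (∫⁻ x, ‖iteratedFDeriv ℝ 1 w x‖ₑ ^ 2 < ⊤) ∧ (∫⁻ x, ‖iteratedFDeriv ℝ 2 w x‖ₑ ^ 2 < ⊤)) →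
      (∫ x, ⟪curl w x, fderiv ℝ w x (curl w x)⟫_ℝ) ≤ c * (∫ x, ‖curl w x‖ ^ 2) ^ (3 / 4 : ℝ) *
        (∫ x, frobeniusNormSq (fderiv ℝ (curl w) x)) ^ (3 / 4 : ℝ))
    (hZm : 0 < ∫ x, ‖curl m x‖ ^ 2) {t : ℝ} (ht : t ∈ Ico 0 T) :
    (∫ x, ‖curl (v t) x‖ ^ 2) ^ 2 * (1 - 2 * (27 * c ^ 4 / (128 * ν ^ 3)) * (∫ x, ‖curl m x‖ ^ 2) ^ 2 * t) ≤
      (∫ x, ‖curl m x‖ ^ 2) ^ 2 := by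
  set Z : ℝ → ℝ := fun s => ∫ x, ‖curl (v s) x‖ ^ 2 with hZdef
  set K : ℝ := 27 * c ^ 4 / (128 * ν ^ 3) with hK
  set Zm : ℝ := ∫ x, ‖curl m x‖ ^ 2 with hZm'
  have hZ0 : ∀ s, 0 ≤ Z s := fun s => integral_nonneg fun x => by positivity
  rcases ht.1.eq_or_lt with h0 | h0
  · subst h0
    show (Z 0) ^ 2 * (1 - 2 * K * Zm ^ 2 * 0) ≤ Zm ^ 2
    have : Z 0 = Zm := by simp only [hZdef, hZm', hv0]
    rw [this]; simp
  rcases (hZ0 t).eq_or_lt with hz | hz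
  · show (Z t) ^ 2 * (1 - 2 * K * Zm ^ 2 * t) ≤ Zm ^ 2
    rw [← hz, zero_pow two_ne_zero, zero_mul]; positivity
  -- positive case: positivity on `[0, t]`, then a bit beyond, then rung zero from `s ↓ 0`
  have htI : t ∈ Ioo 0 T := ⟨h0, ht.2⟩
  have hposL := enstrophy_pos_of_pos_right hν hT hLH hv0 hH1 hcl hB hm hc hZm htI hz
  obtain ⟨t₂, ht₂t, ht₂T, hpos₂⟩ : ∃ t₂, t < t₂ ∧ t₂ ≤ T ∧ ∀ τ ∈ Icc t t₂, 0 < Z τ := by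
    have hev : ∀ᶠ τ in 𝓝 t, 0 < Z τ := (enstrophy_continuousAt hν hcl hB htI).eventually (lt_mem_nhds hz)
    obtain ⟨ε, hε, hball⟩ := Metric.eventually_nhds_iff.1 hev
    refine ⟨min (t + ε / 2) T, lt_min (by linarith) ht.2, min_le_right _ _, fun τ hτ => hball ?_⟩
    rw [Real.dist_eq, abs_lt]
    constructor <;> linarith [hτ.1, hτ.2, min_le_left (t + ε / 2) T]
  have hposAll : ∀ τ ∈ Ico 0 t₂, 0 < Z τ := fun τ hτ => by
    rcases le_or_gt τ t with h | h
    · exact hposL τ ⟨hτ.1, h⟩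
    · exact hpos₂ τ ⟨h.le, hτ.2.le⟩
  -- rung zero from every `s ∈ (0, t)`; let `s → 0⁺`
  have hle : ∀ᶠ s in 𝓝[>] (0 : ℝ), (Z s)⁻¹ ^ 2 - (Z t)⁻¹ ^ 2 ≤ 2 * K * (t - s) := by
    filter_upwards [Ioo_mem_nhdsGT h0] with s hs
    exact inv_sq_sub_inv_sq_le_local hν hcl hB hc hs.1 ht₂T (fun τ hτ => hposAll τ ⟨hs.1.le.trans hτ.1, hτ.2⟩)
      le_rfl hs.2.le ht₂t
  have hZlim := tendsto_enstrophy_nhdsGT hT hLH hv0 hH1 hcl hB hm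
  have hf : Tendsto (fun s => (Z s)⁻¹ ^ 2 - (Z t)⁻¹ ^ 2) (𝓝[>] 0) (𝓝 (Zm⁻¹ ^ 2 - (Z t)⁻¹ ^ 2)) :=
    ((hZlim.inv₀ hZm.ne').pow 2).sub tendsto_const_nhds
  have hg : Tendsto (fun s : ℝ => 2 * K * (t - s)) (𝓝[>] 0) (𝓝 (2 * K * t)) := by
    have h : Tendsto (fun s : ℝ => 2 * K * (t - s)) (𝓝 0) (𝓝 (2 * K * (t - 0))) :=
      ((continuous_const.mul (continuous_const.sub continuous_id)).tendsto 0)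
    rw [sub_zero] at h
    exact h.mono_left nhdsWithin_le_nhds
  have hineq : Zm⁻¹ ^ 2 - (Z t)⁻¹ ^ 2 ≤ 2 * K * t := le_of_tendsto_of_tendsto hf hg hle
  -- multiply out: `Zm⁻² − 2Kt ≤ Z(t)⁻²` ⟹ `Z(t)²(1 − 2K Zm² t) ≤ Zm²`
  show (Z t) ^ 2 * (1 - 2 * K * Zm ^ 2 * t) ≤ Zm ^ 2
  have hZt2 : 0 < (Z t) ^ 2 := pow_pos hz 2
  have hZm2 : 0 < Zm ^ 2 := pow_pos hZm 2
  rw [inv_pow, inv_pow] at hineq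
  have h1 : (Z t) ^ 2 * (1 - 2 * K * Zm ^ 2 * t) = (Z t) ^ 2 * Zm ^ 2 * ((Zm ^ 2)⁻¹ - 2 * K * t) := by
    field_simp
  rw [h1]
  calc (Z t) ^ 2 * Zm ^ 2 * ((Zm ^ 2)⁻¹ - 2 * K * t) ≤ (Z t) ^ 2 * Zm ^ 2 * ((Z t) ^ 2)⁻¹ :=
        mul_le_mul_of_nonneg_left (by linarith) (by positivity)
    _ = Zm ^ 2 := by field_simp

end Window

end ReferenceFlow

end RigidExit

end Summit.NavierStokesRegularity.NavierStokesRegularity.Theorems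

end
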